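import Mathlib
import Summits.KontsevichZagierPeriods.KontsevichZagierPeriods.Theorems.SymplecticScissorsPlanarSAZylevRealise

/-!
# Crux `SymplecticScissors.PlanarSAZylev` (stmt-KontsevichZagierPeriods-9848), line `reservoir-peeling`:
the `K₀` decoding of the planar set-chain group

`assembly_decode`: let `M` be an additive commutative CANCELLATIVE monoid presented as "bounded
`ℚ`-semialgebraic planar sets modulo the pinned pseudogroup equivalence `E`" by a map `mk` (pinned
by `mk A = mk B ↔ E A B`, additivity on disjoint unions, `mk ∅ = 0`), and suppose every finite-area
`ℚ`-region has a bounded `E`-model.  If `[r] − [r']` lies in the planar set-chain group — the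
subgroup of the Kontsevich–Zagier formal group generated by the domain-additivity and
change-of-variables relations supported on planar integrand-`1` representations — then
`E r.domain r'.domain`.

Proof: the class map `χ : KZ.FormalRep →+ K₀(M)` (`FreeAbelianGroup.lift` into the Grothendieck
group, a planar generator `[ρ]` going to the class of a bounded model of its unit set
`ρ.domain ∩ {integrand = 1}`, every other generator to `0`) kills each generator of the group:
a domain-additivity datum splits the unit set into two a.e.-disjoint unit sets
(`assembly_cls_union`; its dimension is `2` by a counting functional), and an off-diagonal
change-of-variables datum in the group has both ends planar with integrand `1` (counting
functionals, as in the refuter's `P1_of_sub_mem_planarGroup`), hence is realised by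
`assembly_realise`.  So `χ[r] = χ[r']`; cancellativity makes `M → K₀(M)` injective
(`Algebra.GrothendieckAddGroup.of_injective`), so the bounded models of `r.domain`, `r'.domain`
have the same class, i.e. are `E`-equivalent.

No definitions. [folklore]
-/

noncomputable section

open MeasureTheory Set
open Literature.NumberTheory.Transcendental Literature.ModelTheory.ExponentialFields

namespace Summit.KontsevichZagierPeriods.SymplecticScissors.PlanarSAZylev

/-- **Counting functional**: if `[ρ] − [ρ']` (`ρ ≠ ρ'` of the same dimension) lies in the
subgroup generated by the planar integrand-`1` generators, then `ρ` is itself (up to the `Σ`-type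
packaging) a planar integrand-`1` representation. [folklore] -/
theorem assembly_exists_planar_of_sub_mem {n : ℕ} {ρ ρ' : KZ.IntegralRep n} (hne : ρ ≠ ρ')
    (h : KZ.of ρ - KZ.of ρ' ∈ AddSubgroup.closure {x : KZ.FormalRep |
      ∃ s : KZ.IntegralRep 2, (∀ p ∈ s.domain, s.integrand p = 1) ∧ x = KZ.of s}) :
    ∃ s : KZ.IntegralRep 2, (∀ p ∈ s.domain, s.integrand p = 1) ∧
      (⟨2, s⟩ : Σ k, KZ.IntegralRep k) = ⟨n, ρ⟩ := by
  classical
  by_contra hno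
  push Not at hno
  let cnt : KZ.FormalRep →+ ℤ :=
    FreeAbelianGroup.lift fun t => if t = (⟨n, ρ⟩ : Σ k, KZ.IntegralRep k) then (1 : ℤ) else 0
  have hcnt : ∀ t : Σ k, KZ.IntegralRep k,
      cnt (FreeAbelianGroup.of t) = if t = ⟨n, ρ⟩ then (1 : ℤ) else 0 :=
    fun t => FreeAbelianGroup.lift_apply_of _ _
  have hker : AddSubgroup.closure {x : KZ.FormalRep |
      ∃ s : KZ.IntegralRep 2, (∀ p ∈ s.domain, s.integrand p = 1) ∧ x = KZ.of s} ≤ cnt.ker := by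
    refine (AddSubgroup.closure_le _).mpr ?_
    rintro _ ⟨s, hs, rfl⟩
    show cnt (KZ.of s) = 0
    rw [KZ.of, hcnt, if_neg (hno s hs)]
  have hne' : (⟨n, ρ'⟩ : Σ k, KZ.IntegralRep k) ≠ ⟨n, ρ⟩ := by
    intro e
    rw [Sigma.mk.inj_iff] at e
    exact hne (eq_of_heq e.2).symm
  have := hker h
  rw [AddMonoidHom.mem_ker, map_sub, KZ.of, KZ.of, hcnt, hcnt, if_pos rfl, if_neg hne'] at this
  norm_num at this

/-- **Dimension count**: a domain-additivity element `[ρ] − [ρ₁] − [ρ₂]` of dimension `n` lying in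
the subgroup generated by planar generators has `n = 2`. [folklore] -/
theorem assembly_dim_eq_two {n : ℕ} {ρ ρ₁ ρ₂ : KZ.IntegralRep n}
    (h : KZ.of ρ - KZ.of ρ₁ - KZ.of ρ₂ ∈ AddSubgroup.closure {x : KZ.FormalRep |
      ∃ s : KZ.IntegralRep 2, (∀ p ∈ s.domain, s.integrand p = 1) ∧ x = KZ.of s}) : n = 2 := by
  classical
  by_contra hn
  let cnt : KZ.FormalRep →+ ℤ :=
    FreeAbelianGroup.lift fun t : Σ k, KZ.IntegralRep k => if t.1 = n then (1 : ℤ) else 0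
  have hcnt : ∀ t : Σ k, KZ.IntegralRep k,
      cnt (FreeAbelianGroup.of t) = if t.1 = n then (1 : ℤ) else 0 :=
    fun t => FreeAbelianGroup.lift_apply_of _ _
  have hker : AddSubgroup.closure {x : KZ.FormalRep |
      ∃ s : KZ.IntegralRep 2, (∀ p ∈ s.domain, s.integrand p = 1) ∧ x = KZ.of s} ≤ cnt.ker := by
    refine (AddSubgroup.closure_le _).mpr ?_
    rintro _ ⟨s, -, rfl⟩
    show cnt (KZ.of s) = 0
    rw [KZ.of, hcnt, if_neg (Ne.symm hn)]
  have := hker h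
  rw [AddMonoidHom.mem_ker, map_sub, map_sub, KZ.of, KZ.of, KZ.of, hcnt, hcnt, hcnt,
    if_pos rfl] at this
  norm_num at this

/-- **The `K₀` decoding.** See the module docstring. [cite: Boltianskii1978, §16 Thm 22] -/
theorem assembly_decode (E : Set (Fin 2 → ℝ) → Set (Fin 2 → ℝ) → Prop)
    (HE : ∀ A B : Set (Fin 2 → ℝ), E A B ↔
        ∃ (U : Set (Fin 2 → ℝ)) (Φ : (Fin 2 → ℝ) → (Fin 2 → ℝ)),
          U ⊆ A ∧ IsSemialgebraic ℚ U ∧ IsOpen U ∧ volume (A \ U) = 0 ∧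
          IsSemialgebraicMapOn ℚ U Φ ∧ ContDiffOn ℝ 1 Φ U ∧ InjOn Φ U ∧
          (∀ p ∈ U, |(fderiv ℝ Φ p).det| = 1) ∧ Φ '' U ⊆ B ∧ volume (B \ Φ '' U) = 0)
    (hsymm : ∀ A B : Set (Fin 2 → ℝ), E A B → E B A)
    (htrans : ∀ A B C : Set (Fin 2 → ℝ), E A B → E B C → E A C)
    (hglue : ∀ A₁ A₂ B₁ B₂ : Set (Fin 2 → ℝ), volume (A₁ ∩ A₂) = 0 → Disjoint B₁ B₂ →
      E A₁ B₁ → E A₂ B₂ → E (A₁ ∪ A₂) (B₁ ∪ B₂))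
    (hcompress : ∀ S : Set (Fin 2 → ℝ), IsSemialgebraic ℚ S → volume S ≠ ⊤ →
      ∃ K : Set (Fin 2 → ℝ), IsSemialgebraic ℚ K ∧ Bornology.IsBounded K ∧ E S K)
    {M : Type*} [AddCommMonoid M]
    (mk : {A : Set (Fin 2 → ℝ) // IsSemialgebraic ℚ A ∧ Bornology.IsBounded A} → M)
    (hmk_eq : ∀ A B : {A : Set (Fin 2 → ℝ) // IsSemialgebraic ℚ A ∧ Bornology.IsBounded A},
      mk A = mk B ↔ E A.1 B.1)
    (hmk_add : ∀ A B : {A : Set (Fin 2 → ℝ) // IsSemialgebraic ℚ A ∧ Bornology.IsBounded A},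
      Disjoint A.1 B.1 → mk A + mk B = mk ⟨A.1 ∪ B.1, A.2.1.union B.2.1, A.2.2.union B.2.2⟩)
    (hcancel : ∀ a b c : M, a + c = b + c → a = b)
    (r r' : KZ.IntegralRep 2) (h1 : ∀ p ∈ r.domain, r.integrand p = 1)
    (h1' : ∀ p ∈ r'.domain, r'.integrand p = 1)
    (hG : KZ.of r - KZ.of r' ∈ AddSubgroup.closure ((KZ.domainAddRel ∪ KZ.changeOfVariablesRel) ∩
      (AddSubgroup.closure {x : KZ.FormalRep | ∃ s : KZ.IntegralRep 2,
        (∀ p ∈ s.domain, s.integrand p = 1) ∧ x = KZ.of s} : Set KZ.FormalRep))) :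
    E r.domain r'.domain := by
  classical
  -- the class of a finite-area region: the class of a chosen bounded model
  have hcls0 : ∀ S : Set (Fin 2 → ℝ), IsSemialgebraic ℚ S → volume S ≠ ⊤ →
      ∃ K : {A : Set (Fin 2 → ℝ) // IsSemialgebraic ℚ A ∧ Bornology.IsBounded A}, E S K.1 := by
    intro S hS hv
    obtain ⟨K, hK, hKb, e⟩ := hcompress S hS hv
    exact ⟨⟨K, hK, hKb⟩, e⟩
  haveI : Nonempty {A : Set (Fin 2 → ℝ) // IsSemialgebraic ℚ A ∧ Bornology.IsBounded A} :=
    ⟨⟨∅, isSemialgebraic_empty, Bornology.isBounded_empty⟩⟩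
  let cls : Set (Fin 2 → ℝ) → M := fun S =>
    mk (Classical.epsilon fun K : {A : Set (Fin 2 → ℝ) // IsSemialgebraic ℚ A ∧
      Bornology.IsBounded A} => E S K.1)
  have hcls : ∀ S : Set (Fin 2 → ℝ), IsSemialgebraic ℚ S → volume S ≠ ⊤ →
      ∃ K : {A : Set (Fin 2 → ℝ) // IsSemialgebraic ℚ A ∧ Bornology.IsBounded A},
        E S K.1 ∧ cls S = mk K :=
    fun S hS hv => ⟨_, Classical.epsilon_spec (hcls0 S hS hv), rfl⟩
  -- the class of a generator of the formal group: the class of the unit set, for planar ones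
  let clS : (Σ k, KZ.IntegralRep k) → M := fun t =>
    match t with
    | ⟨2, ρ⟩ => cls (ρ.domain ∩ {x | ρ.integrand x = 1})
    | _ => 0
  have hclS : ∀ ρ : KZ.IntegralRep 2, clS ⟨2, ρ⟩ = cls (ρ.domain ∩ {x | ρ.integrand x = 1}) :=
    fun ρ => rfl
  -- the Grothendieck group and the class homomorphism
  haveI : IsCancelAdd M :=
    { add_left_cancel := fun a b c h => hcancel b c a (by
        have h' : a + b = a + c := h
        rwa [add_comm a b, add_comm a c] at h')
      add_right_cancel := fun a b c h => hcancel b c a h }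
  let ι : M →+ Algebra.GrothendieckAddGroup M := Algebra.GrothendieckAddGroup.of
  have hι : Function.Injective ι := Algebra.GrothendieckAddGroup.of_injective
  let χ : KZ.FormalRep →+ Algebra.GrothendieckAddGroup M := FreeAbelianGroup.lift fun t => ι (clS t)
  have hχ : ∀ ρ : KZ.IntegralRep 2, χ (KZ.of ρ) = ι (cls (ρ.domain ∩ {x | ρ.integrand x = 1})) :=
    fun ρ => by rw [KZ.of]; exact (FreeAbelianGroup.lift_apply_of _ _).trans (by rw [hclS])
  -- `χ` kills the generators of the planar set-chain group
  have hker : AddSubgroup.closure ((KZ.domainAddRel ∪ KZ.changeOfVariablesRel) ∩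
      (AddSubgroup.closure {x : KZ.FormalRep | ∃ s : KZ.IntegralRep 2,
        (∀ p ∈ s.domain, s.integrand p = 1) ∧ x = KZ.of s} : Set KZ.FormalRep)) ≤ χ.ker := by
    refine (AddSubgroup.closure_le _).mpr ?_
    rintro c ⟨hc | hc, hcP⟩
    · -- domain additivity
      obtain ⟨n, ρ, ρ₁, ρ₂, hdom, hnull, he₁, he₂, rfl⟩ := hc
      have hn : n = 2 := assembly_dim_eq_two hcP
      subst hn
      show χ (KZ.of ρ - KZ.of ρ₁ - KZ.of ρ₂) = 0
      rw [map_sub, map_sub, hχ, hχ, hχ]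
      obtain ⟨hU, hI⟩ := assembly_unitSet_union hdom he₁ he₂
      rw [hU, assembly_cls_union E HE hsymm htrans hglue mk hmk_eq hmk_add cls hcls
        (assembly_isSemialgebraic_unitSet ρ₁) (assembly_volume_unitSet_ne_top ρ₁)
        (assembly_isSemialgebraic_unitSet ρ₂) (assembly_volume_unitSet_ne_top ρ₂)
        (measure_mono_null hI hnull), map_add]
      abel
    · -- change of variables
      obtain ⟨n, ρ, ρ', Φ, Φ', hΦsa, hΦ', hinj, hdom, hint, rfl⟩ := hc
      by_cases heq : ρ = ρ'
      · subst heq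
        simp
      obtain ⟨s, hs1, hseq⟩ := assembly_exists_planar_of_sub_mem heq hcP
      obtain ⟨hn, hsρ⟩ := Sigma.mk.inj_iff.1 hseq
      subst hn
      obtain rfl : s = ρ := eq_of_heq hsρ
      have hcP' : KZ.of ρ' - KZ.of s ∈ AddSubgroup.closure {x : KZ.FormalRep |
          ∃ s : KZ.IntegralRep 2, (∀ p ∈ s.domain, s.integrand p = 1) ∧ x = KZ.of s} := by
        have := AddSubgroup.neg_mem _ hcP
        rwa [neg_sub] at this
      obtain ⟨s', hs'1, hs'eq⟩ := assembly_exists_planar_of_sub_mem (Ne.symm heq) hcP'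
      obtain ⟨-, hs'ρ⟩ := Sigma.mk.inj_iff.1 hs'eq
      obtain rfl : s' = ρ' := eq_of_heq hs'ρ
      show χ (KZ.of s - KZ.of s') = 0
      rw [map_sub, hχ, hχ, assembly_unitSet_eq s hs1, assembly_unitSet_eq s' hs'1, sub_eq_zero]
      congr 1
      -- the Jacobian has absolute value one on the source
      have hdet : ∀ x ∈ s.domain, |(Φ' x).det| = 1 := by
        intro x hx
        have h := hint x hx
        rw [hs1 x hx, hs'1 (Φ x) (by rw [hdom]; exact ⟨x, hx, rfl⟩), one_mul] at h
        exact h.symm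
      refine assembly_cls_congr E hsymm htrans mk hmk_eq cls hcls s.isSemialgebraic_domain
        (by rw [← assembly_unitSet_eq s hs1]; exact assembly_volume_unitSet_ne_top s)
        s'.isSemialgebraic_domain
        (by rw [← assembly_unitSet_eq s' hs'1]; exact assembly_volume_unitSet_ne_top s') ?_
      rw [hdom]
      exact assembly_realise E HE s.isSemialgebraic_domain hΦsa hΦ' hinj hdet
  -- conclusion
  have h0 := hker hG
  rw [AddMonoidHom.mem_ker, map_sub, hχ, hχ, sub_eq_zero, assembly_unitSet_eq r h1,
    assembly_unitSet_eq r' h1'] at h0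
  have hcl : cls r.domain = cls r'.domain := hι h0
  obtain ⟨K, hK, hcK⟩ := hcls r.domain r.isSemialgebraic_domain
    (by rw [← assembly_unitSet_eq r h1]; exact assembly_volume_unitSet_ne_top r)
  obtain ⟨K', hK', hcK'⟩ := hcls r'.domain r'.isSemialgebraic_domain
    (by rw [← assembly_unitSet_eq r' h1']; exact assembly_volume_unitSet_ne_top r')
  rw [hcK, hcK', hmk_eq] at hcl
  exact htrans _ _ _ hK (htrans _ _ _ hcl (hsymm _ _ hK'))

/-- **The `K₀` decoding** (stub `stub_decode` of the line, the lead's reshaping of its assembly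
stub; = `assembly_decode` as a closed statement). [cite: Boltianskii1978, §16 Thm 22] -/
theorem stub_decode :
    ∀ (E : Set (Fin 2 → ℝ) → Set (Fin 2 → ℝ) → Prop),
      (∀ A B : Set (Fin 2 → ℝ), E A B ↔
        ∃ (U : Set (Fin 2 → ℝ)) (Φ : (Fin 2 → ℝ) → (Fin 2 → ℝ)),
          U ⊆ A ∧ IsSemialgebraic ℚ U ∧ IsOpen U ∧ volume (A \ U) = 0 ∧
          IsSemialgebraicMapOn ℚ U Φ ∧ ContDiffOn ℝ 1 Φ U ∧ InjOn Φ U ∧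
          (∀ p ∈ U, |(fderiv ℝ Φ p).det| = 1) ∧ Φ '' U ⊆ B ∧ volume (B \ Φ '' U) = 0) →
    (∀ A B : Set (Fin 2 → ℝ), E A B → E B A) →
    (∀ A B C : Set (Fin 2 → ℝ), E A B → E B C → E A C) →
    (∀ A₁ A₂ B₁ B₂ : Set (Fin 2 → ℝ), volume (A₁ ∩ A₂) = 0 → Disjoint B₁ B₂ →
      E A₁ B₁ → E A₂ B₂ → E (A₁ ∪ A₂) (B₁ ∪ B₂)) →
    (∀ S : Set (Fin 2 → ℝ), IsSemialgebraic ℚ S → volume S ≠ ⊤ →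
      ∃ K : Set (Fin 2 → ℝ), IsSemialgebraic ℚ K ∧ Bornology.IsBounded K ∧ E S K) →
    ∀ (M : Type) [AddCommMonoid M]
      (mk : {A : Set (Fin 2 → ℝ) // IsSemialgebraic ℚ A ∧ Bornology.IsBounded A} → M),
      (∀ A B : {A : Set (Fin 2 → ℝ) // IsSemialgebraic ℚ A ∧ Bornology.IsBounded A},
        mk A = mk B ↔ E A.1 B.1) →
      (∀ A B : {A : Set (Fin 2 → ℝ) // IsSemialgebraic ℚ A ∧ Bornology.IsBounded A},
        Disjoint A.1 B.1 → mk A + mk B = mk ⟨A.1 ∪ B.1, A.2.1.union B.2.1, A.2.2.union B.2.2⟩) →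
      (∀ a b c : M, a + c = b + c → a = b) →
      ∀ (r r' : KZ.IntegralRep 2), (∀ p ∈ r.domain, r.integrand p = 1) →
        (∀ p ∈ r'.domain, r'.integrand p = 1) →
        KZ.of r - KZ.of r' ∈ AddSubgroup.closure ((KZ.domainAddRel ∪ KZ.changeOfVariablesRel) ∩
          (AddSubgroup.closure {x : KZ.FormalRep | ∃ s : KZ.IntegralRep 2,
            (∀ p ∈ s.domain, s.integrand p = 1) ∧ x = KZ.of s} : Set KZ.FormalRep)) →
        E r.domain r'.domain := by
  intro E HE hsymm htrans hglue hcompress M _ mk hmk_eq hmk_add hcancel r r' h1 h1' hG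
  exact assembly_decode E HE hsymm htrans hglue hcompress mk hmk_eq hmk_add hcancel r r' h1 h1' hG

end Summit.KontsevichZagierPeriods.SymplecticScissors.PlanarSAZylev
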